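import Literature.AlgebraicGeometry.PlaneCurves.PolarConicHessian
import HarnessLib

/-!
# The Cayleyan curve of a member of the Hesse pencil (Artebani–Dolgachev, Prop. 3.3)

Topic `Literature/AlgebraicGeometry/PlaneCurves`, namespace `Literature.AlgebraicGeometry.PlaneCurves`.
Lane `lit-hodgefound`, seat `lit-hodgefound-p37`, row g18-#4; a one-file sequel of
`PolarConicHessian` (g18-#2: the polar conic `P_q(H_μ) = 3[u(X² − μYZ) + v(Y² − μXZ) + w(Z² − μXY)]`
of a point `q = (u, v, w)`, `hesse_polar`).  Everything here is PROVED; no definition, no named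
fact.

Source followed — M. Artebani, I. Dolgachev, *The Hesse pencil of plane cubic curves*,
L'Enseignement Math. (2) 55 (2009) 235–273 [arXiv:math/0611590, held `paper:arxiv-math_0611590`
p0006 L37–L52, p0007 L1–L11], §3, VERBATIM:

> The quotient `He(E)/⟨η⟩` is isomorphic to the cubic curve in the dual plane `ℙ̌²`
> parametrizing the lines `q s_q`. This curve is classically known as the Cayleyan curve of `E`.
> One can show that the Cayleyan curve also parametrizes the line components of reducible polar
> conics of `E`. […]
> **Proposition 3.3.** If `E = E_λ` is a member of the Hesse pencil, then its Cayleyan curve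
> `Ca(E_λ)` is the member of the dual Hesse pencil corresponding to the parameter
> `𝔠(λ) = (54 − λ³)/(9λ)`.   (cay)
> To see this, following [CL], p. 245, we write the equation of the polar conic `P_q(E_{6μ})` with
> respect to a point `q = (u, v, w)`: `u(x² + 2μyz) + v(y² + 2μxz) + w(z² + 2μxy) = 0.` It is a
> reducible conic if the equation decomposes into linear factors
> `u(x² + 2μyz) + v(y² + 2μxz) + w(z² + 2μxy) = (ax + by + cz)(αx + βy + γz).` This happens if
> and only if [the symmetric `3 × 3` matrix of the left side equals that of the right side].
> Considering this as a system of linear equations in the variables `u, v, w, a, b, c` we get the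
> condition of solvability as the vanishing of the determinant
> `[6 × 6] = μ(α³ + β³ + γ³) + (1 − 4μ³)αβγ = 0`. If we take `(α, β, γ)` as the coordinates in
> the dual plane, this equation represents the equation of the Cayleyan curve because the line
> `αx + βy + γz` is an irreducible component of a singular polar conic. Plugging in `μ = λ/6`, we
> get (cay). […] One checks that `𝔥(−18/λ) = 𝔠(λ)`.

## Dictionary

* `H_μ = X³ + Y³ + Z³ − 3μXYZ` (local notation `𝐇[μ]`) is `E_λ` at `λ = −3μ`, i.e. the source's
  `E_{6μ′}` at `μ′ = −μ/2`; in this normalisation the printed cubic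
  `μ′(α³ + β³ + γ³) + (1 − 4μ′³)αβγ` is `−½ · [μ(α³ + β³ + γ³) − (2 + μ³)αβγ]`.
* "the line `αX + βY + γZ` is a component of the (reducible) polar conic of some point `q`" is
  WRITTEN OUT as: `∃ q ≠ 0, ∃ (a, b, c), P_q(H_μ) = (aX + bY + cZ)(αX + βY + γZ)` in `K[X, Y, Z]`,
  with `P_q(H_μ) = Σ qᵢ∂ᵢH_μ` as in `PolarConicHessian`; the coefficient vector `(α, β, γ)` is
  the point of the dual plane.  No definition ("Cayleyan") is introduced: the curve is the
  explicit cubic `μ(α³ + β³ + γ³) − (2 + μ³)αβγ`.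
* Eliminating `u = aα`, `v = bβ`, `w = cγ` (here `3u = aα`, …) from the printed `6 × 6` system
  leaves the `3 × 3` system `N·(a, b, c)ᵀ = 0`, `N = [[β, α, μγ], [γ, μβ, α], [μα, γ, β]]`, whose
  determinant is the printed cubic (`det_cayleyanMatrix`).

## What is here

* §1 `det_cayleyanMatrix` — `det N = μ(α³ + β³ + γ³) − (2 + μ³)αβγ`; `linearForm_eq_zero_iff`.
* §2 **Prop. 3.3, the computation**: `hesse_polar_eq_mul_iff` — the six coefficient equations;
  **`hesse_lineComponent_polar_iff`** — for `3 ≠ 0` and `(α, β, γ) ≠ 0`, the line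
  `αX + βY + γZ` is a component of the polar conic `P_q(H_μ)` of some point `q ≠ 0` IF AND ONLY IF
  `μ(α³ + β³ + γ³) − (2 + μ³)αβγ = 0` ("this equation represents the equation of the Cayleyan
  curve because the line `αx + βy + γz` is an irreducible component of a singular polar conic").
* §3 **Prop. 3.3, the parameter**: `cayleyan_eq_mul_eval_dual` — for `μ ≠ 0`, `3 ≠ 0`,
  `μ(α³ + β³ + γ³) − (2 + μ³)αβγ = μ · H_ν(α, β, γ)` with `ν = (μ³ + 2)/(3μ)`: the Cayleyan of
  `H_μ` is the member `H_ν` of the dual Hesse pencil; in the source's parameters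
  (`cayleyan_iff_dual'`, `λ = −3μ ≠ 0`, `2, 3 ≠ 0`): iff `α³ + β³ + γ³ + 𝔠(λ)αβγ = 0` with
  **`𝔠(λ) = (54 − λ³)/(9λ)`** — formula (cay); and `hessianParameter_eq_cayleyanParameter` —
  **"One checks that `𝔥(−18/λ) = 𝔠(λ)`"** (`𝔥(t) = −(108 + t³)/(3t²)`).
* §4 Sanity: the inflection tangents `(μw, 1, w²)` and the harmonic polars `(0, 1, −w²)` of
  `H_μ` (`w³ = 1`; the line components of the polars at the base points) satisfy the Cayleyan
  equation (`cayleyan_inflectionTangent`, `cayleyan_harmonicPolar`).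

Hypotheses, compared with the source: Artebani–Dolgachev work over an algebraically closed field
of characteristic `≠ 2, 3`; §2 holds over every field with `3 ≠ 0` (no algebraic closure: the
factorisation is an identity of polynomials), §3 needs `λ ≠ 0` for (cay) (for the Fermat cubic
the Cayleyan is the triangle `αβγ = 0`, `hesse_lineComponent_polar_iff` at `μ = 0`).  NOT here:
`Ca(E) ≅ He(E)/⟨η⟩`, the points `s_q`, the map `α : λ ↦ μ` with `𝔥(α(λ)) = 𝔠(λ)` beyond the
displayed identity, Remark 3.4 (the dual curves), Remark 3.5 (dynamics of `𝔥`, `𝔠`).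

## References
* [ArtebaniDolgachev2009] M. Artebani, I. Dolgachev, *The Hesse pencil of plane cubic curves*,
  Enseign. Math. (2) 55 (2009) 235–273, §3, Prop. 3.3 and its proof, formula (cay).
* [DolgachevKanev1993] I. Dolgachev, V. Kanev, *Polar covariants of plane cubics and quartics*,
  Adv. Math. 98 (1993) 216–301, (5.3) (the Cayleyan variety of a cubic).
-/

set_option autoImplicit false

open MvPolynomial Matrix

namespace Literature.AlgebraicGeometry.PlaneCurves

universe u

/-- The Hesse cubic `H_μ = X³ + Y³ + Z³ − 3μXYZ` (local notation as in the statements of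
`HessePencilWeierstrassForm`, no definition). -/
local notation3 "𝐇[" μ "]" =>
  (X 0 ^ 3 + X 1 ^ 3 + X 2 ^ 3 - C (3 * μ) * (X 0 * X 1 * X 2) : MvPolynomial (Fin 3) _)

section Cayleyan

variable {K : Type u} [Field K]

/-! ## §1 The `3 × 3` system left after eliminating `u, v, w` -/

/-- **The determinant of the reduced system**: for `N = [[β, α, μγ], [γ, μβ, α], [μα, γ, β]]`,
`det N = μ(α³ + β³ + γ³) − (2 + μ³)αβγ` (the printed `6 × 6` determinant
`μ′(α³ + β³ + γ³) + (1 − 4μ′³)αβγ`, `μ′ = −μ/2`, up to the factor `−½`).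
[cite: ArtebaniDolgachev2009, §3, proof of Prop. 3.3 (the determinant)] -/
theorem det_cayleyanMatrix (μ : K) (l : Fin 3 → K) :
    (Matrix.of ![![l 1, l 0, μ * l 2], ![l 2, μ * l 1, l 0], ![μ * l 0, l 2, l 1]]).det =
      μ * (l 0 ^ 3 + l 1 ^ 3 + l 2 ^ 3) - (2 + μ ^ 3) * (l 0 * l 1 * l 2) := by
  rw [Matrix.det_fin_three]
  simp
  ring

/-- A linear form `aX + bY + cZ` is the zero polynomial iff `(a, b, c) = 0`. [folklore] -/
private theorem linearForm_eq_zero_iff (a : Fin 3 → K) :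
    (∑ i, C (a i) * X i : MvPolynomial (Fin 3) K) = 0 ↔ a = 0 := by
  constructor
  · intro h
    funext i
    fin_cases i
    · simpa [Fin.sum_univ_three] using congrArg (eval ![(1 : K), 0, 0]) h
    · simpa [Fin.sum_univ_three] using congrArg (eval ![(0 : K), 1, 0]) h
    · simpa [Fin.sum_univ_three] using congrArg (eval ![(0 : K), 0, 1]) h
  · rintro rfl
    simp

/-! ## §2 Line components of reducible polar conics -/

/-- **The six coefficient equations** ("This happens if and only if [the two symmetric matrices
agree]"): `P_q(H_μ) = (aX + bY + cZ)(αX + βY + γZ)` in `K[X, Y, Z]` iff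
`3u = aα`, `3v = bβ`, `3w = cγ`, `−3μw = aβ + bα`, `−3μv = aγ + cα`, `−3μu = bγ + cβ`
(the printed system with `u, v, w` scaled by `3` and `2μ′ = −μ`).
[cite: ArtebaniDolgachev2009, §3, proof of Prop. 3.3 (the matrix equation)] -/
theorem hesse_polar_eq_mul_iff (μ : K) (q a l : Fin 3 → K) :
    ∑ i, C (q i) * pderiv i 𝐇[μ] = (∑ i, C (a i) * X i) * (∑ i, C (l i) * X i) ↔
      3 * q 0 = a 0 * l 0 ∧ 3 * q 1 = a 1 * l 1 ∧ 3 * q 2 = a 2 * l 2 ∧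
        -(3 * μ * q 2) = a 0 * l 1 + a 1 * l 0 ∧ -(3 * μ * q 1) = a 0 * l 2 + a 2 * l 0 ∧
          -(3 * μ * q 0) = a 1 * l 2 + a 2 * l 1 := by
  rw [hesse_polar]
  constructor
  · intro h
    have e100 := congrArg (eval ![(1 : K), 0, 0]) h
    have e010 := congrArg (eval ![(0 : K), 1, 0]) h
    have e001 := congrArg (eval ![(0 : K), 0, 1]) h
    have e011 := congrArg (eval ![(0 : K), 1, 1]) h
    have e101 := congrArg (eval ![(1 : K), 0, 1]) h
    have e110 := congrArg (eval ![(1 : K), 1, 0]) h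
    simp [Fin.sum_univ_three] at e100 e010 e001 e011 e101 e110
    refine ⟨by linear_combination e100, by linear_combination e010, by linear_combination e001,
      by linear_combination e110 - e100 - e010, by linear_combination e101 - e100 - e001,
      by linear_combination e011 - e010 - e001⟩
  · rintro ⟨h0, h1, h2, h01, h02, h12⟩
    have H0 := congrArg (C : K →+* MvPolynomial (Fin 3) K) h0
    have H1 := congrArg (C : K →+* MvPolynomial (Fin 3) K) h1
    have H2 := congrArg (C : K →+* MvPolynomial (Fin 3) K) h2
    have H01 := congrArg (C : K →+* MvPolynomial (Fin 3) K) h01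
    have H02 := congrArg (C : K →+* MvPolynomial (Fin 3) K) h02
    have H12 := congrArg (C : K →+* MvPolynomial (Fin 3) K) h12
    simp only [map_mul, map_add, map_neg, map_ofNat] at H0 H1 H2 H01 H02 H12
    simp only [Fin.sum_univ_three, map_ofNat]
    linear_combination (X 0 ^ 2 : MvPolynomial (Fin 3) K) * H0 + (X 1 ^ 2) * H1 + (X 2 ^ 2) * H2 +
      (X 0 * X 1) * H01 + (X 0 * X 2) * H02 + (X 1 * X 2) * H12

/-- **Artebani–Dolgachev Prop. 3.3, the computation: "this equation represents the equation of
the Cayleyan curve because the line `αx + βy + γz` is an irreducible component of a singular polar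
conic"** — over a field with `3 ≠ 0`, for `(α, β, γ) ≠ 0`: the line `αX + βY + γZ` is a
component of the polar conic `P_q(H_μ) = Σ qᵢ∂ᵢH_μ` of some point `q ≠ 0` (i.e.
`P_q(H_μ) = (aX + bY + cZ)(αX + βY + γZ)` for some `a, b, c`) IF AND ONLY IF
`μ(α³ + β³ + γ³) − (2 + μ³)αβγ = 0`. [cite: ArtebaniDolgachev2009, §3, Prop. 3.3 (proof)]
[cite: DolgachevKanev1993, (5.3) (the Cayleyan variety)] -/
theorem hesse_lineComponent_polar_iff (h3 : (3 : K) ≠ 0) (μ : K) {l : Fin 3 → K} (hl : l ≠ 0) :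
    (∃ q : Fin 3 → K, q ≠ 0 ∧ ∃ a : Fin 3 → K,
        ∑ i, C (q i) * pderiv i 𝐇[μ] = (∑ i, C (a i) * X i) * (∑ i, C (l i) * X i)) ↔
      μ * (l 0 ^ 3 + l 1 ^ 3 + l 2 ^ 3) - (2 + μ ^ 3) * (l 0 * l 1 * l 2) = 0 := by
  rw [← det_cayleyanMatrix, ← Matrix.exists_mulVec_eq_zero_iff]
  constructor
  · rintro ⟨q, hq, a, h⟩
    obtain ⟨h0, h1, h2, h01, h02, h12⟩ := (hesse_polar_eq_mul_iff μ q a l).1 h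
    refine ⟨a, ?_, ?_⟩
    · rintro rfl
      simp only [Pi.zero_apply, zero_mul] at h0 h1 h2
      apply hq
      funext i
      fin_cases i
      · exact (mul_eq_zero.1 h0).resolve_left h3
      · exact (mul_eq_zero.1 h1).resolve_left h3
      · exact (mul_eq_zero.1 h2).resolve_left h3
    · funext i
      fin_cases i
      · simp [Matrix.mulVec, dotProduct, Fin.sum_univ_three]
        linear_combination -h01 - μ * h2
      · simp [Matrix.mulVec, dotProduct, Fin.sum_univ_three]
        linear_combination -h02 - μ * h1
      · simp [Matrix.mulVec, dotProduct, Fin.sum_univ_three]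
        linear_combination -h12 - μ * h0
  · rintro ⟨a, ha, hN⟩
    have E0 := congr_fun hN 0
    have E1 := congr_fun hN 1
    have E2 := congr_fun hN 2
    simp [Matrix.mulVec, dotProduct, Fin.sum_univ_three] at E0 E1 E2
    -- `E0 : βa₀ + αa₁ + μγa₂ = 0`, `E1 : γa₀ + μβa₁ + αa₂ = 0`, `E2 : μαa₀ + γa₁ + βa₂ = 0`;
    -- the pole `q = (a₀α, a₁β, a₂γ)` and the cofactor `3(a₀X + a₁Y + a₂Z)`
    have hid : ∑ i, C ((![a 0 * l 0, a 1 * l 1, a 2 * l 2] : Fin 3 → K) i) * pderiv i 𝐇[μ] =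
        (∑ i, C ((fun i => 3 * a i) i) * X i) * (∑ i, C (l i) * X i) := by
      refine (hesse_polar_eq_mul_iff μ _ _ l).2 ⟨?_, ?_, ?_, ?_, ?_, ?_⟩
      · simp; ring
      · simp; ring
      · simp
        ring
      · simp
        linear_combination (-3 : K) * E0
      · simp
        linear_combination (-3 : K) * E1
      · simp
        linear_combination (-3 : K) * E2
    refine ⟨![a 0 * l 0, a 1 * l 1, a 2 * l 2], ?_, fun i => 3 * a i, hid⟩
    intro hq
    have hz : (∑ i, C ((fun i => 3 * a i) i) * X i : MvPolynomial (Fin 3) K) *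
        (∑ i, C (l i) * X i) = 0 := by
      rw [← hid, hq]
      simp
    rcases mul_eq_zero.1 hz with hz | hz
    · apply ha
      have h3a := (linearForm_eq_zero_iff (fun i => 3 * a i)).1 hz
      funext i
      exact (mul_eq_zero.1 (congr_fun h3a i)).resolve_left h3
    · exact hl ((linearForm_eq_zero_iff l).1 hz)

/-! ## §3 The Cayleyan is a member of the dual Hesse pencil: formula (cay) -/

/-- **Prop. 3.3, the parameter**: for `μ ≠ 0` (`3 ≠ 0`),
`μ(α³ + β³ + γ³) − (2 + μ³)αβγ = μ · H_ν(α, β, γ)` with `ν = (μ³ + 2)/(3μ)` — the Cayleyan curve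
of `H_μ` is the member `α³ + β³ + γ³ − 3ναβγ` of the dual Hesse pencil.
[cite: ArtebaniDolgachev2009, §3, Prop. 3.3] -/
theorem cayleyan_eq_mul_eval_dual (h3 : (3 : K) ≠ 0) {μ : K} (hμ : μ ≠ 0) (l : Fin 3 → K) :
    μ * (l 0 ^ 3 + l 1 ^ 3 + l 2 ^ 3) - (2 + μ ^ 3) * (l 0 * l 1 * l 2) =
      μ * eval l 𝐇[(μ ^ 3 + 2) / (3 * μ)] := by
  rw [hesse_eval]
  have e : 3 * ((μ ^ 3 + 2) / (3 * μ)) = (μ ^ 3 + 2) / μ := by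
    field_simp
  rw [e]
  field_simp
  ring

/-- **Formula (cay): "its Cayleyan curve `Ca(E_λ)` is the member of the dual Hesse pencil
corresponding to the parameter `𝔠(λ) = (54 − λ³)/(9λ)`"** — in the source's parameters
(`λ = −3μ ≠ 0`; `2, 3 ≠ 0`): the Cayleyan equation `μ(α³ + β³ + γ³) − (2 + μ³)αβγ = 0` holds
iff `α³ + β³ + γ³ + 𝔠(λ)·αβγ = 0`. [cite: ArtebaniDolgachev2009, §3, Prop. 3.3, formula (cay)] -/
theorem cayleyan_iff_dual' (h3 : (3 : K) ≠ 0) {μ la : K} (hla : la ≠ 0) (hμ : la = -3 * μ)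
    (l : Fin 3 → K) :
    μ * (l 0 ^ 3 + l 1 ^ 3 + l 2 ^ 3) - (2 + μ ^ 3) * (l 0 * l 1 * l 2) = 0 ↔
      l 0 ^ 3 + l 1 ^ 3 + l 2 ^ 3 + (54 - la ^ 3) / (9 * la) * (l 0 * l 1 * l 2) = 0 := by
  subst hμ
  have hμ0 : μ ≠ 0 := by rintro rfl; exact hla (by ring)
  have h9 : (9 : K) ≠ 0 := by
    rw [show (9 : K) = 3 * 3 by norm_num]
    exact mul_ne_zero h3 h3
  have key : l 0 ^ 3 + l 1 ^ 3 + l 2 ^ 3 + (54 - (-3 * μ) ^ 3) / (9 * (-3 * μ)) * (l 0 * l 1 * l 2) =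
      μ⁻¹ * (μ * (l 0 ^ 3 + l 1 ^ 3 + l 2 ^ 3) - (2 + μ ^ 3) * (l 0 * l 1 * l 2)) := by
    field_simp
    ring
  rw [key, mul_eq_zero, or_iff_right (inv_ne_zero hμ0)]

/-- **"One checks that `𝔥(−18/λ) = 𝔠(λ)`"**: with `𝔥(t) = −(108 + t³)/(3t²)` (formula (hes)) and
`𝔠(λ) = (54 − λ³)/(9λ)`, for `λ ≠ 0` and `2, 3 ≠ 0`.
[cite: ArtebaniDolgachev2009, §3 (after Prop. 3.3)] -/
theorem hessianParameter_eq_cayleyanParameter (h2 : (2 : K) ≠ 0) (h3 : (3 : K) ≠ 0) {la : K}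
    (hla : la ≠ 0) :
    -(108 + (-18 / la) ^ 3) / (3 * (-18 / la) ^ 2) = (54 - la ^ 3) / (9 * la) := by
  have h18 : (18 : K) ≠ 0 := by
    rw [show (18 : K) = 2 * 3 ^ 2 by norm_num]
    exact mul_ne_zero h2 (pow_ne_zero 2 h3)
  have h9 : (9 : K) ≠ 0 := by
    rw [show (9 : K) = 3 ^ 2 by norm_num]
    exact pow_ne_zero 2 h3
  field_simp
  ring

/-- The same identity in the `μ`-normalisation of this file: `𝔥(ν) = (4 − ν³)/(3ν²)`
(`HessePencilHessian.det_hessianMatrix_hesse_eq_smul`) at `ν = −2/μ` (i.e. `t = −18/λ`) equals the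
Cayleyan parameter `(μ³ + 2)/(3μ)`. [cite: ArtebaniDolgachev2009, §3 (after Prop. 3.3)] -/
theorem hessianParameter_eq_cayleyanParameter' (h2 : (2 : K) ≠ 0) (h3 : (3 : K) ≠ 0) {μ : K}
    (hμ : μ ≠ 0) :
    (4 - (-2 / μ) ^ 3) / (3 * (-2 / μ) ^ 2) = (μ ^ 3 + 2) / (3 * μ) := by
  field_simp
  ring

/-! ## §4 The inflection tangents and the harmonic polars lie on the Cayleyan -/

/-- The inflection tangents `(μw, 1, w²)` of `H_μ` (`w³ = 1`) — the line components
`𝕋_p(H_μ)` of the polars at the base points — satisfy the Cayleyan equation.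
[cite: ArtebaniDolgachev2009, §3 ("the Cayleyan curve also parametrizes the line components of
reducible polar conics")] -/
theorem cayleyan_inflectionTangent (μ : K) {w : K} (hw : w ^ 3 = 1) :
    μ * ((μ * w) ^ 3 + 1 ^ 3 + (w ^ 2) ^ 3) - (2 + μ ^ 3) * (μ * w * 1 * w ^ 2) = 0 := by
  linear_combination (μ ^ 4 + μ * w ^ 3 + μ - (2 + μ ^ 3) * μ) * hw

/-- The harmonic polars `(0, 1, −w²)` (`w³ = 1`) — the other line components of the polars at
the base points, base points of the dual pencil — satisfy the Cayleyan equation.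
[cite: ArtebaniDolgachev2009, §3 (the harmonic polars; the Cayleyan)] -/
theorem cayleyan_harmonicPolar (μ : K) {w : K} (hw : w ^ 3 = 1) :
    μ * ((0 : K) ^ 3 + 1 ^ 3 + (-w ^ 2) ^ 3) - (2 + μ ^ 3) * (0 * 1 * -w ^ 2) = 0 := by
  linear_combination (-(μ * (w ^ 3 + 1))) * hw

end Cayleyan

end Literature.AlgebraicGeometry.PlaneCurves
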